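import Mathlib
import Summits.Ventures.PercRepro2.Defs
import Summits.Ventures.PercRepro2.ThreeEventCertificate

/-!
# The antipodal count `Φ(J)` and its induction by ANTIPODAL certificates (blind cell PercRepro2, p4 g35)

For an admissible quadruple `J = (G, H, M, B)` on a finite cube `Config E = E → Bool` the ANTIPODAL COUNT is
`Φ(J) := Σ_ω c(ω̄, ω)` — the two-sample pair weight `pairWt` summed over the antipodal pairs `(ω̄, ω)`
(`ω̄` = every edge flipped; the G-sample at the antipode, the H-sample at `ω`). A product measure has
`μ(x)μ(y) = μ(x ⊓ y)μ(x ⊔ y)`, so the defect `Ψ_p` is the sum over the intervals `[w, z]` of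
`μ(w)μ(z)·Φ(J|[w,z])`: `Φ ≥ 0` on every sub-cube is a WEIGHT-FREE strengthening of the three-event
lemma (L) (the cell's (FIB″)); that bridge is not in this file.

Pinning an edge `e`, the antipodal pairs of the cube are in bijection with the configurations `ω` with
`e` open through the `e`-ANTIPODE `antipodeAt e ω` (every edge but `e` flipped, `e` open), and
`Φ(J) = Σ_{ω e = true} χ_e(antipodeAt e ω, ω)` (`antiCount_eq_sum_cross`), `χ_e(x, y) = c(x[e↦0], y) +
c(x, y[e↦0])` the cross pair weight of the pinning identity. So a symmetrised pointwise certificate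
`Σ λ_i c_i^sym ≤ χ_e^sym` is needed ONLY at the antipodal pairs `(antipodeAt e ω, ω)`: summing it gives
`Φ(J) ≥ Σ λ_i Φ_e(J_i)` (`antiCount_ge_of_antipodal_certificate`), `Φ_e(J_i)` the antipodal count of
the section of `J_i` at `e` open, an instance of the smaller cube `{f // f ≠ e}`
(`antiCountAt_eq_antiCount_secAt`). The induction on the dimension is ThreeEventAntipodalInduction. No
weight vector appears. Definitions `antipode`, `antipodeAt`, `extendAt`, `restrictAt`, `secAt`,
`antiCount`, `antiCountAt`; no instance, no notation.
-/

namespace Summit.Ventures.PercRepro2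

namespace ThreeEvent

section AntipodalDefs

variable {E : Type*} [DecidableEq E]

/-- The antipode of a configuration: every edge flipped. -/
def antipode (ω : Config E) : Config E := fun f => !ω f

omit [DecidableEq E] in
/-- The antipode is an involution. -/
lemma antipode_antipode (ω : Config E) : antipode (antipode ω) = ω := by
  funext f
  simp [antipode]

/-- The `e`-antipode: every edge but `e` flipped, `e` open. -/
def antipodeAt (e : E) (ω : Config E) : Config E := Function.update (antipode ω) e true

/-- The `e`-antipode has `e` open. -/
lemma antipodeAt_apply_self (e : E) (ω : Config E) : antipodeAt e ω e = true := by
  simp [antipodeAt]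

/-- Off `e` the `e`-antipode flips. -/
lemma antipodeAt_apply_of_ne (e : E) (ω : Config E) {f : E} (h : f ≠ e) :
    antipodeAt e ω f = !ω f := by
  simp [antipodeAt, Function.update_of_ne h, antipode]

/-- On the configurations with `e` open, the `e`-antipode is an involution. -/
lemma antipodeAt_antipodeAt (e : E) {ω : Config E} (h : ω e = true) :
    antipodeAt e (antipodeAt e ω) = ω := by
  funext f
  by_cases hf : f = e
  · subst hf
    rw [antipodeAt_apply_self, h]
  · rw [antipodeAt_apply_of_ne e _ hf, antipodeAt_apply_of_ne e ω hf, Bool.not_not]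

/-- Closing `e` in the `e`-antipode of a configuration with `e` open gives the antipode. -/
lemma update_antipodeAt_false (e : E) {ω : Config E} (h : ω e = true) :
    Function.update (antipodeAt e ω) e false = antipode ω := by
  funext f
  by_cases hf : f = e
  · subst hf
    simp [antipode, h]
  · rw [Function.update_of_ne hf, antipodeAt_apply_of_ne e ω hf]
    rfl

/-- The antipode of a configuration with `e` closed is the `e`-antipode of the same configuration
with `e` open. -/
lemma antipode_update_false (e : E) {ω : Config E} (h : ω e = true) :
    antipode (Function.update ω e false) = antipodeAt e ω := by
  funext f
  by_cases hf : f = e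
  · subst hf
    simp [antipode, antipodeAt]
  · rw [antipodeAt_apply_of_ne e ω hf]
    simp [antipode, Function.update_of_ne hf]

/-- Gluing a configuration of the sub-cube without `e` to `e` open. -/
def extendAt (e : E) (σ : Config {f // f ≠ e}) : Config E :=
  fun f => if h : f = e then true else σ ⟨f, h⟩

/-- Restricting a configuration to the sub-cube without `e`. -/
def restrictAt (e : E) (ω : Config E) : Config {f // f ≠ e} := fun i => ω i.1

/-- The section of an event at `e` open, as an event of the sub-cube without `e`. -/
def secAt (e : E) (S : Set (Config E)) : Set (Config {f // f ≠ e}) := {σ | extendAt e σ ∈ S}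

/-- Gluing opens `e`. -/
lemma extendAt_apply_self (e : E) (σ : Config {f // f ≠ e}) : extendAt e σ e = true := by
  simp [extendAt]

/-- Gluing off `e` is the sub-cube configuration. -/
lemma extendAt_apply_of_ne (e : E) (σ : Config {f // f ≠ e}) {f : E} (h : f ≠ e) :
    extendAt e σ f = σ ⟨f, h⟩ := by
  simp [extendAt, h]

/-- Restricting a glued configuration gives back the sub-cube configuration. -/
lemma restrictAt_extendAt (e : E) (σ : Config {f // f ≠ e}) : restrictAt e (extendAt e σ) = σ := by
  funext i
  simp [restrictAt, extendAt_apply_of_ne e σ i.2]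

/-- Gluing the restriction of a configuration with `e` open gives it back. -/
lemma extendAt_restrictAt (e : E) {ω : Config E} (h : ω e = true) :
    extendAt e (restrictAt e ω) = ω := by
  funext f
  by_cases hf : f = e
  · subst hf
    rw [extendAt_apply_self, h]
  · rw [extendAt_apply_of_ne e _ hf]
    rfl

/-- Restriction commutes with the antipodes. -/
lemma restrictAt_antipodeAt (e : E) (ω : Config E) :
    restrictAt e (antipodeAt e ω) = antipode (restrictAt e ω) := by
  funext i
  simp [restrictAt, antipode, antipodeAt_apply_of_ne e ω i.2]

/-- Gluing commutes with the antipodes. -/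
lemma extendAt_antipode (e : E) (σ : Config {f // f ≠ e}) :
    extendAt e (antipode σ) = antipodeAt e (extendAt e σ) := by
  funext f
  by_cases hf : f = e
  · subst hf
    rw [extendAt_apply_self, antipodeAt_apply_self]
  · rw [extendAt_apply_of_ne e _ hf, antipodeAt_apply_of_ne e _ hf, extendAt_apply_of_ne e σ hf]
    rfl

/-- Gluing is monotone. -/
lemma extendAt_mono (e : E) {σ σ' : Config {f // f ≠ e}} (h : σ ≤ σ') :
    extendAt e σ ≤ extendAt e σ' := by
  intro f
  by_cases hf : f = e
  · subst hf
    rw [extendAt_apply_self, extendAt_apply_self]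
  · rw [extendAt_apply_of_ne e _ hf, extendAt_apply_of_ne e _ hf]
    exact h _

/-- Membership in a section. -/
lemma mem_secAt (e : E) (S : Set (Config E)) (σ : Config {f // f ≠ e}) :
    σ ∈ secAt e S ↔ extendAt e σ ∈ S := Iff.rfl

/-- Sections commute with intersections. -/
lemma secAt_inter (e : E) (S T : Set (Config E)) : secAt e (S ∩ T) = secAt e S ∩ secAt e T := rfl

/-- Sections preserve inclusions. -/
lemma secAt_mono (e : E) {S T : Set (Config E)} (h : S ⊆ T) : secAt e S ⊆ secAt e T :=
  fun _ hσ => h hσ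

/-- The section of an upper set is an upper set. -/
lemma isUpperSet_secAt (e : E) {S : Set (Config E)} (hS : IsUpperSet S) : IsUpperSet (secAt e S) :=
  fun _ _ h hσ => hS (extendAt_mono e h) hσ

/-- The section of a lower set is a lower set. -/
lemma isLowerSet_secAt (e : E) {S : Set (Config E)} (hS : IsLowerSet S) : IsLowerSet (secAt e S) :=
  fun _ _ h hσ => hS (extendAt_mono e h) hσ

/-- The indicator of an event at a glued configuration is the indicator of the section. -/
lemma indicator_extendAt {R : Type*} [CommRing R] (e : E) (S : Set (Config E))
    (σ : Config {f // f ≠ e}) :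
    S.indicator (1 : Config E → R) (extendAt e σ) = (secAt e S).indicator 1 σ := by
  by_cases h : extendAt e σ ∈ S
  · rw [Set.indicator_of_mem h, Set.indicator_of_mem (show σ ∈ secAt e S from h)]
    rfl
  · rw [Set.indicator_of_notMem h, Set.indicator_of_notMem (show σ ∉ secAt e S from h)]

end AntipodalDefs

section AntiCount

variable {E : Type*} [Fintype E] [DecidableEq E] {R : Type*} [CommRing R]

/-- The antipodal count `Φ(J) = Σ_ω c(ω̄, ω)`. -/
noncomputable def antiCount (G H M B : Set (Config E)) : R :=
  ∑ ω, pairWt G H M B (antipode ω) ω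

/-- The antipodal count of the section of `J` at `e` open, written on the cube of `E`:
`Φ_e(J) = Σ_{ω e = true} c(antipodeAt e ω, ω)`. -/
noncomputable def antiCountAt (e : E) (G H M B : Set (Config E)) : R :=
  ∑ ω ∈ Finset.univ.filter (fun ω : Config E => ω e = true), pairWt G H M B (antipodeAt e ω) ω

omit [Fintype E] in
/-- The pair weight of the sections at glued configurations is the pair weight of the quadruple. -/
lemma pairWt_secAt (e : E) (G H M B : Set (Config E)) (σ σ' : Config {f // f ≠ e}) :
    pairWt (secAt e G) (secAt e H) (secAt e M) (secAt e B) σ σ'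
      = (pairWt G H M B (extendAt e σ) (extendAt e σ') : R) := by
  simp only [pairWt, ← secAt_inter, indicator_extendAt]

/-- `Φ_e(J)` is the antipodal count of the section of `J` at `e` open on the sub-cube without `e`. -/
theorem antiCountAt_eq_antiCount_secAt (e : E) (G H M B : Set (Config E)) :
    antiCountAt e G H M B = (antiCount (secAt e G) (secAt e H) (secAt e M) (secAt e B) : R) := by
  unfold antiCountAt antiCount
  refine Finset.sum_nbij' (restrictAt e) (extendAt e) ?_ ?_ ?_ ?_ ?_
  · intro ω _
    exact Finset.mem_univ _
  · intro σ _
    simp [extendAt_apply_self]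
  · intro ω hω
    simp only [Finset.mem_filter, Finset.mem_univ, true_and] at hω
    exact extendAt_restrictAt e hω
  · intro σ _
    exact restrictAt_extendAt e σ
  · intro ω hω
    simp only [Finset.mem_filter, Finset.mem_univ, true_and] at hω
    rw [pairWt_secAt, extendAt_antipode, extendAt_restrictAt e hω]

/-- **The antipodal count through the pinning at `e`**: the antipodal pairs of the cube are the pairs
`(antipodeAt e ω, ω)` with `e` open in `ω` (the pair with the H-sample `ω`) and their companions with
`e` closed in the H-sample; `Φ(J) = Σ_{ω e = true} [c(ω̄, ω) + c(antipodeAt e ω, ω[e↦0])]`. -/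
theorem antiCount_eq_sum_cross (e : E) (G H M B : Set (Config E)) :
    (antiCount G H M B : R)
      = ∑ ω ∈ Finset.univ.filter (fun ω : Config E => ω e = true),
          (pairWt G H M B (Function.update (antipodeAt e ω) e false) ω
            + pairWt G H M B (antipodeAt e ω) (Function.update ω e false)) := by
  unfold antiCount
  rw [← Finset.sum_filter_add_sum_filter_not Finset.univ (fun ω : Config E => ω e = true),
    Finset.sum_add_distrib]
  congr 1
  · refine Finset.sum_congr rfl fun ω hω => ?_
    simp only [Finset.mem_filter, Finset.mem_univ, true_and] at hω
    rw [update_antipodeAt_false e hω]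
  · refine Finset.sum_nbij' (fun ω => Function.update ω e true) (fun ω => Function.update ω e false)
      ?_ ?_ ?_ ?_ ?_
    · intro ω _
      simp
    · intro ω _
      simp
    · intro ω hω
      simp only [Finset.mem_filter, Finset.mem_univ, true_and, Bool.not_eq_true] at hω
      rw [Function.update_idem, ← hω, Function.update_eq_self]
    · intro ω hω
      simp only [Finset.mem_filter, Finset.mem_univ, true_and] at hω
      rw [Function.update_idem, ← hω, Function.update_eq_self]
    · intro ω hω
      simp only [Finset.mem_filter, Finset.mem_univ, true_and, Bool.not_eq_true] at hω
      have h1 : Function.update ω e true e = true := by simp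
      have h2 : Function.update (Function.update ω e true) e false = ω := by
        rw [Function.update_idem, ← hω, Function.update_eq_self]
      have h3 := antipode_update_false e h1
      rw [h2] at h3
      rw [h2, ← h3]

/-- Reindexing a sum over the configurations with `e` open by the `e`-antipode. -/
lemma sum_antipodeAt (e : E) (F : Config E → R) :
    ∑ ω ∈ Finset.univ.filter (fun ω : Config E => ω e = true), F (antipodeAt e ω)
      = ∑ ω ∈ Finset.univ.filter (fun ω : Config E => ω e = true), F ω := by
  refine Finset.sum_nbij' (antipodeAt e) (antipodeAt e) ?_ ?_ ?_ ?_ ?_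
  · intro ω _
    simp [antipodeAt_apply_self]
  · intro ω _
    simp [antipodeAt_apply_self]
  · intro ω hω
    simp only [Finset.mem_filter, Finset.mem_univ, true_and] at hω
    exact antipodeAt_antipodeAt e hω
  · intro ω hω
    simp only [Finset.mem_filter, Finset.mem_univ, true_and] at hω
    exact antipodeAt_antipodeAt e hω
  · intro ω _
    rfl

/-- Twice the antipodal count as the sum of the SYMMETRISED cross pair weight over the antipodal pairs
`(antipodeAt e ω, ω)`, `e` open in `ω`. -/
theorem two_mul_antiCount_eq (e : E) (G H M B : Set (Config E)) :
    2 * (antiCount G H M B : R)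
      = ∑ ω ∈ Finset.univ.filter (fun ω : Config E => ω e = true),
          ((pairWt G H M B (Function.update (antipodeAt e ω) e false) ω
              + pairWt G H M B (antipodeAt e ω) (Function.update ω e false))
            + (pairWt G H M B (Function.update ω e false) (antipodeAt e ω)
              + pairWt G H M B ω (Function.update (antipodeAt e ω) e false))) := by
  rw [Finset.sum_add_distrib, two_mul]
  congr 1
  · exact antiCount_eq_sum_cross e G H M B
  · rw [antiCount_eq_sum_cross e G H M B]
    rw [← sum_antipodeAt e (fun ω => pairWt G H M B (Function.update (antipodeAt e ω) e false) ω
      + pairWt G H M B (antipodeAt e ω) (Function.update ω e false))]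
    refine Finset.sum_congr rfl fun ω hω => ?_
    simp only [Finset.mem_filter, Finset.mem_univ, true_and] at hω
    rw [antipodeAt_antipodeAt e hω]

/-- Twice `Φ_e(J)` as the symmetrised antipodal sum. -/
theorem two_mul_antiCountAt_eq (e : E) (G H M B : Set (Config E)) :
    2 * (antiCountAt e G H M B : R)
      = ∑ ω ∈ Finset.univ.filter (fun ω : Config E => ω e = true),
          (pairWt G H M B ω (antipodeAt e ω) + pairWt G H M B (antipodeAt e ω) ω) := by
  rw [Finset.sum_add_distrib, two_mul, add_comm]
  congr 1
  unfold antiCountAt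
  rw [← sum_antipodeAt e (fun ω => pairWt G H M B (antipodeAt e ω) ω)]
  refine Finset.sum_congr rfl fun ω hω => ?_
  simp only [Finset.mem_filter, Finset.mem_univ, true_and] at hω
  rw [antipodeAt_antipodeAt e hω]

end AntiCount

section Certificate

variable {R : Type*} [CommRing R] [LinearOrder R] [IsStrictOrderedRing R]

/-- **The antipodal certificate inequality**: if, at every antipodal pair `(antipodeAt e ω, ω)` with
`e` open in `ω`, `Σ_i λ_i c_i^sym ≤ χ_e^sym`, then `Σ_i λ_i Φ_e(J_i) ≤ Φ(J)`. -/
theorem antiCount_ge_of_antipodal_certificate {E : Type*} [Fintype E] [DecidableEq E] (e : E)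
    (G H M B : Set (Config E)) {k : ℕ} (G₁ H₁ M₁ B₁ : Fin k → Set (Config E)) (l : Fin k → R)
    (hcert : ∀ ω : Config E, ω e = true →
      (∑ i, l i * (pairWt (G₁ i) (H₁ i) (M₁ i) (B₁ i) ω (antipodeAt e ω)
          + pairWt (G₁ i) (H₁ i) (M₁ i) (B₁ i) (antipodeAt e ω) ω))
        ≤ (pairWt G H M B (Function.update ω e false) (antipodeAt e ω)
            + pairWt G H M B ω (Function.update (antipodeAt e ω) e false))
          + (pairWt G H M B (Function.update (antipodeAt e ω) e false) ω
            + pairWt G H M B (antipodeAt e ω) (Function.update ω e false))) :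
    ∑ i, l i * antiCountAt e (G₁ i) (H₁ i) (M₁ i) (B₁ i) ≤ (antiCount G H M B : R) := by
  have h2 : (2 : R) * ∑ i, l i * antiCountAt e (G₁ i) (H₁ i) (M₁ i) (B₁ i)
      ≤ 2 * antiCount G H M B := by
    rw [two_mul_antiCount_eq e, Finset.mul_sum]
    simp_rw [mul_left_comm (2 : R), two_mul_antiCountAt_eq e, Finset.mul_sum]
    rw [Finset.sum_comm]
    refine Finset.sum_le_sum fun ω hω => ?_
    simp only [Finset.mem_filter, Finset.mem_univ, true_and] at hω
    have := hcert ω hω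
    linarith [this]
  exact le_of_mul_le_mul_left h2 two_pos

end Certificate

end ThreeEvent

end Summit.Ventures.PercRepro2
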